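import Summits.BirchSwinnertonDyer.Uniform.U2.GenusPointRingClass
import Summits.BirchSwinnertonDyer.Uniform.U2.RingClassRestrictionTrace
import HarnessLib

/-!
# Cell «bsd-uniform», track U2, route C — Theorem A′ (first half) for TWO inert `a_q`-odd primes,
# `M = q₁q₂`, assembled end-to-end from the landed one-step fact

HONEST FRAMING (cell «bsd-uniform», run/shared/lean/pub/bsd-uniform/, seat u2-p3): a THEOREM under
named binders, no claim about BSD beyond it; the worked composite-conductor example showing that the
route-C pipeline closes: the printed one-step relation `CoatesLiTianZhai2015.traceRelation_inert`
(Lemma 2.9 "general fact"), used TWICE — at top field `K[q₁q₂]` for the step `K[q₁q₂]/K[q₁]`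
(multiplier `a_{q₂}`) and at top field `K[q₁]` for the step `K[q₁]/K[1]` (multiplier `a_{q₁}`) —, the
second transported into `Gal(K[q₁q₂]/K)` by `RingClassRestrictionTrace.sum_quotient_pointGalHom_eq_smul_of_finsum_step`,
folded by `GenusCongruence.sum_eq_mul_smul_of_two_steps` to the composed relation
`Σ_{Gal(K[q₁q₂]/K)} σ·y = a_{q₂}a_{q₁} · y_K` (with Gross's (4.1) `Tr_{K[1]/K} y₁ = y_K` as the data
binder `hyK`), and fed to `GenusPointRingClass.genusPoint_not_isOfFinAddOrder_of_trace`.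
Conductors are spelled `1 * q₁` and `1 * q₁ * q₂` (the fact's `M * p` with `M = 1`, resp. `M = 1 * q₁`).
Binders as in the one-prime theorem: L1 (`h2L`), (H-y) (`hHy`, per base pair), the data `y, z, y₁, y_K`.
-/

noncomputable section

open scoped Classical

open WeierstrassCurve NumberField Literature.NumberTheory.EllipticCurves
  Literature.NumberTheory.EllipticCurves.ModularForms

set_option autoImplicit false

namespace Summit.BirchSwinnertonDyer.Uniform.U2.RingClass

/-- **Theorem A′, first half, two inert `a_q`-odd primes (`M = q₁q₂`).** Under the printed binders
of `CoatesLiTianZhai2015.traceRelation_inert` (`E/ℚ` globally minimal of conductor `N`,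
`K = ℚ(√−ℓ₀)`, Heegner hypothesis, `q₁, q₂ ∤ N` inert primes) with `a_{q₁}, a_{q₂}` ODD, data
`y ↦ x(q₁q₂)`, `z ↦ x(q₁)`, `y₁ ↦ x(1)` and `y_K ∈ E(K)` with `Tr_{K[1]/K} y₁ = y_K` (Gross (4.1),
binder `hyK`, read in `E(K[q₁q₂])`), L1 (`h2L`) and (H-y) (`hHy`): for every sign function `s` on
`Gal(K[q₁q₂]/K)` — in particular the genus character `χ_{q₁q₂}` — the point `Σ_σ s(σ)·σy` has
infinite order in `E(K[q₁q₂])`. [folklore] -/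
theorem genusPoint_not_isOfFinAddOrder_inert_two (hCLTZ : CoatesLiTianZhai2015.traceRelation_inert)
    (W : WeierstrassCurve ℚ) [W.IsElliptic] [W.IsGloballyMinimal] [NeZero (W.conductorNorm ℤ)]
    {K : Type} [Field K] [NumberField K] (hK : IsImaginaryQuadratic K)
    (ℓ₀ : ℕ) (hℓ₀ : ℓ₀.Prime) (hℓ₀' : 3 < ℓ₀) (hℓ₀'' : ℓ₀ % 4 = 3)
    (hKℓ₀ : NumberField.discr K = -(ℓ₀ : ℤ))
    (hH : SatisfiesHeegnerHypothesis (W.conductorNorm ℤ) K)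
    (ι : K →+* ℂ) (Dt : ModularParametrizationData W (W.conductorNorm ℤ)) (β : ℤ)
    (hβ : (4 * (W.conductorNorm ℤ : ℤ)) ∣ β ^ 2 - NumberField.discr K)
    (q₁ q₂ : ℕ) (hq₁ : q₁.Prime) (hq₂ : q₂.Prime) (hq₁C : Nat.Coprime q₁ (W.conductorNorm ℤ))
    (hq₂C : Nat.Coprime q₂ (1 * q₁ * W.conductorNorm ℤ))
    (hinert₁ : (Ideal.span {(q₁ : 𝓞 K)}).IsPrime) (hinert₂ : (Ideal.span {(q₂ : 𝓞 K)}).IsPrime)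
    [NumberField (ringClassField K ι (1 * q₁))] [NumberField (ringClassField K ι (1 * q₁ * q₂))]
    (y : (W.baseChange (ringClassField K ι (1 * q₁ * q₂) : Type)).toAffine.Point)
    (hy : WeierstrassCurve.Affine.Point.map (ringClassField K ι (1 * q₁ * q₂)).subtype.toRatAlgHom y =
      heegnerPointComplexOfConductor Dt (NumberField.discr K) β (1 * q₁ * q₂))
    (z : (W.baseChange (ringClassField K ι (1 * q₁) : Type)).toAffine.Point)
    (hz : WeierstrassCurve.Affine.Point.map (ringClassField K ι (1 * q₁)).subtype.toRatAlgHom z =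
      heegnerPointComplexOfConductor Dt (NumberField.discr K) β (1 * q₁))
    (y₁ : (W.baseChange (ringClassField K ι 1 : Type)).toAffine.Point)
    (hy₁ : WeierstrassCurve.Affine.Point.map (ringClassField K ι 1).subtype.toRatAlgHom y₁ =
      heegnerPointComplexOfConductor Dt (NumberField.discr K) β 1)
    (hn : 1 * q₁ * q₂ ≠ 0) (hq₁n : 1 * q₁ ∣ 1 * q₁ * q₂)
    (yK : (W.baseChange K).toAffine.Point)
    (hyK : ∑ c : ringClassGal ι (1 * q₁ * q₂) ⧸
        (ringClassGalOver ι (1 * q₁ * q₂) 1).subgroupOf (ringClassGal ι (1 * q₁ * q₂)),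
        pointGalHom W (ringClassField K ι (1 * q₁ * q₂)) (c.out : ringClassGal ι (1 * q₁ * q₂)).1
          (WeierstrassCurve.Affine.Point.map (W' := W)
            (RingClassField.inclusion ι
              (ringClassField_mono hK ι ((one_dvd (1 * q₁)).trans hq₁n) hn)).toRingHom.toRatAlgHom y₁) =
      WeierstrassCurve.Affine.Point.map (W' := W)
        (algebraMap K (ringClassField K ι (1 * q₁ * q₂))).toRatAlgHom yK)
    (h2L : ∀ Q : (W.baseChange (ringClassField K ι (1 * q₁ * q₂) : Type)).toAffine.Point,
      (2 : ℕ) • Q = 0 → Q = 0)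
    (hHy : ¬ ∃ R : (W.baseChange K).toAffine.Point, (2 : ℕ) • R = yK)
    (haq₁ : Odd (W.frobeniusTrace q₁)) (haq₂ : Odd (W.frobeniusTrace q₂))
    (s : ringClassGal ι (1 * q₁ * q₂) → ℤˣ) :
    ¬ IsOfFinAddOrder (∑ σ : ringClassGal ι (1 * q₁ * q₂), (s σ : ℤ) •
      pointGalHom W (ringClassField K ι (1 * q₁ * q₂)) σ.1 y) := by
  have h1q₁0 : 1 * q₁ ≠ 0 := mul_ne_zero one_ne_zero hq₁.ne_zero
  have h1q₁ : 1 ∣ 1 * q₁ := one_dvd _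
  have hMC : Nat.Coprime (1 * q₁) (W.conductorNorm ℤ) := by rw [one_mul]; exact hq₁C
  -- TOP STEP `K[q₁q₂]/K[q₁]` (fact at `M = 1*q₁`, `p = q₂`), with `y_M := incl z`
  have hzL : WeierstrassCurve.Affine.Point.map (ringClassField K ι (1 * q₁ * q₂)).subtype.toRatAlgHom
      (WeierstrassCurve.Affine.Point.map (W' := W)
        (RingClassField.inclusion ι (ringClassField_mono hK ι hq₁n hn)).toRingHom.toRatAlgHom z) =
      heegnerPointComplexOfConductor Dt (NumberField.discr K) β (1 * q₁) := by
    rw [map_subtype_map_inclusion ι hK hq₁n hn W z, hz]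
  have hrelC := hCLTZ W K hK ℓ₀ hℓ₀ hℓ₀' hℓ₀'' hKℓ₀ hH ι Dt β hβ (1 * q₁) h1q₁0 hMC q₂ hq₂ hq₂C
    hinert₂ y hy
  rw [← hzL] at hrelC
  have htop₀ := sum_pointGalHom_eq_smul_of_finsum ι (1 * q₁ * q₂) W (1 * q₁) y _ _ hrelC
  have hleG : ringClassGalOver ι (1 * q₁ * q₂) (1 * q₁) ≤ ringClassGal ι (1 * q₁ * q₂) :=
    ringClassGalOver_le_ringClassGal ι _ _
  have htop : ∑ h : (ringClassGalOver ι (1 * q₁ * q₂) (1 * q₁)).subgroupOf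
      (ringClassGal ι (1 * q₁ * q₂)),
      ((pointGalHom W (ringClassField K ι (1 * q₁ * q₂))).comp
        (ringClassGal ι (1 * q₁ * q₂)).subtype) (h : ringClassGal ι (1 * q₁ * q₂)) y =
      (W.frobeniusTrace q₂) • WeierstrassCurve.Affine.Point.map (W' := W)
        (RingClassField.inclusion ι (ringClassField_mono hK ι hq₁n hn)).toRingHom.toRatAlgHom z := by
    rw [← htop₀]
    exact Fintype.sum_equiv (Subgroup.subgroupOfEquivOfLe hleG).toEquiv _ _ (fun h => rfl)
  -- MID STEP `K[q₁]/K[1]` (fact at `M = 1`, `p = q₁`, top field `K[1*q₁]`), then transported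
  have hy₁' : WeierstrassCurve.Affine.Point.map (ringClassField K ι (1 * q₁)).subtype.toRatAlgHom
      (WeierstrassCurve.Affine.Point.map (W' := W)
        (RingClassField.inclusion ι (ringClassField_mono hK ι h1q₁ h1q₁0)).toRingHom.toRatAlgHom y₁) =
      heegnerPointComplexOfConductor Dt (NumberField.discr K) β 1 := by
    rw [map_subtype_map_inclusion ι hK h1q₁ h1q₁0 W y₁, hy₁]
  have hrelC₁ := hCLTZ W K hK ℓ₀ hℓ₀ hℓ₀' hℓ₀'' hKℓ₀ hH ι Dt β hβ 1 one_ne_zero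
    (Nat.coprime_one_left _) q₁ hq₁ (by rw [one_mul]; exact hq₁C) hinert₁ z hz
  rw [← hy₁'] at hrelC₁
  have hmid₁ := sum_pointGalHom_eq_smul_of_finsum ι (1 * q₁) W 1 z _ _ hrelC₁
  have hmid₀ := sum_quotient_pointGalHom_eq_smul_of_step ι hK hq₁n hn h1q₁ W z y₁
    (W.frobeniusTrace q₁) hmid₁
  have hmid : ∑ e : ((ringClassGalOver ι (1 * q₁ * q₂) 1).subgroupOf (ringClassGal ι (1 * q₁ * q₂))) ⧸
      (((ringClassGalOver ι (1 * q₁ * q₂) (1 * q₁)).subgroupOf (ringClassGal ι (1 * q₁ * q₂))).subgroupOf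
        ((ringClassGalOver ι (1 * q₁ * q₂) 1).subgroupOf (ringClassGal ι (1 * q₁ * q₂)))),
      ((pointGalHom W (ringClassField K ι (1 * q₁ * q₂))).comp
        (ringClassGal ι (1 * q₁ * q₂)).subtype)
        ((e.out : (ringClassGalOver ι (1 * q₁ * q₂) 1).subgroupOf (ringClassGal ι (1 * q₁ * q₂))) :
          ringClassGal ι (1 * q₁ * q₂))
        (WeierstrassCurve.Affine.Point.map (W' := W)
          (RingClassField.inclusion ι (ringClassField_mono hK ι hq₁n hn)).toRingHom.toRatAlgHom z) =
      (W.frobeniusTrace q₁) • WeierstrassCurve.Affine.Point.map (W' := W)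
        (RingClassField.inclusion ι
          (ringClassField_mono hK ι (h1q₁.trans hq₁n) hn)).toRingHom.toRatAlgHom y₁ := by
    simp only [MonoidHom.comp_apply, Subgroup.coe_subtype]
    exact hmid₀
  -- FOLD the two steps in `Gal(K[q₁q₂]/K)` and insert Gross's (4.1)
  have hle : (ringClassGalOver ι (1 * q₁ * q₂) (1 * q₁)).subgroupOf (ringClassGal ι (1 * q₁ * q₂)) ≤
      (ringClassGalOver ι (1 * q₁ * q₂) 1).subgroupOf (ringClassGal ι (1 * q₁ * q₂)) :=
    fun σ hσ => Subgroup.mem_subgroupOf.mpr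
      (ringClassGalOver_anti ι hK hq₁n hn h1q₁ (Subgroup.mem_subgroupOf.mp hσ))
  have hyq : ∀ h : (ringClassGalOver ι (1 * q₁ * q₂) (1 * q₁)).subgroupOf
      (ringClassGal ι (1 * q₁ * q₂)),
      ((pointGalHom W (ringClassField K ι (1 * q₁ * q₂))).comp
        (ringClassGal ι (1 * q₁ * q₂)).subtype) (h : ringClassGal ι (1 * q₁ * q₂))
        (WeierstrassCurve.Affine.Point.map (W' := W)
          (RingClassField.inclusion ι (ringClassField_mono hK ι hq₁n hn)).toRingHom.toRatAlgHom z) =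
      WeierstrassCurve.Affine.Point.map (W' := W)
        (RingClassField.inclusion ι (ringClassField_mono hK ι hq₁n hn)).toRingHom.toRatAlgHom z := by
    intro h
    simp only [MonoidHom.comp_apply, Subgroup.coe_subtype]
    exact pointGalHom_map_inclusion_eq_of_mem ι hK hq₁n hn W (Subgroup.mem_subgroupOf.mp h.2) z
  have htr := GenusCongruence.sum_eq_mul_smul_of_two_steps
    ((pointGalHom W (ringClassField K ι (1 * q₁ * q₂))).comp (ringClassGal ι (1 * q₁ * q₂)).subtype)
    hle hyq htop hmid
  simp only [MonoidHom.comp_apply, Subgroup.coe_subtype] at htr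
  rw [hyK] at htr
  exact genusPoint_not_isOfFinAddOrder_of_trace W hK ι hn y yK (Int.odd_mul.mpr ⟨haq₂, haq₁⟩) htr
    h2L hHy s

end Summit.BirchSwinnertonDyer.Uniform.U2.RingClass

end
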